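import Summits.QuantumFields.YangMills.Theorems.FluctuationComparisonRegPrIntLS2BetaLaplaceInstLocal
import HarnessLib

/-!
# S2β · LAPLACE row — (CT): LIMIT-INST AT A SHIFTED BASE POINT OF A PRODUCT TUBE (the common-tube transfer for FOUR-POINT-DECAY) (pen w5-20520 g14)

Cell `ym3-torus` (rung R3: continuum `SU(2)` Yang–Mills on `T³` — NOT `d = 4`, NOT infinite volume, NOT a mass gap, NOT Clay); width seat `ym-ust-20520-w5` g14;
helper of the crux `stmt-QuantumFields-20520` (`--supports`, NOT a proof of it).  THEOREMS ONLY (0 `def`, 0 `sorry`; default heartbeats).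

WHY (FOUR-POINT-DECAY, LINE g18-1 v9.1 — the last LAPLACE residue).  px21's tubular Haar chart around the minimiser orbit is a PRODUCT: window `UZ ×ˢ UV`, density
`dZ(z)·dV(y)` (✓`…S2BetaTreeGaugeChart` l.140–141; exported as (F1)(F2)(F3) by px21 g11).  In the COMMON TUBE of one corner `U` of a quadrilateral, the minimiser orbit of a
nearby datum `x'` meets the transversal at a point `σ y₁`, `y₁ = y(x') ∈ UV` near `0`; this file instantiates ✓LIMIT-INST (`…LaplaceInstLocal.laplaceLimit_of_charts_tendsto_local`,
p740884) AT THAT SHIFTED BASE POINT with the SAME `e, ρ, Sst` and the translated transversal `σ ∘ (y₁ + ·)`: the scaled restricted partition function of the datum tends to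
  `(2π)^{dV/2} · ν(univ) · (((∫_{ball ρ} dZ) · dV y₁) ∕ ν((e '' ball ρ)·Sst)) · jac(σ y₁) ∕ √det Ah ∕ β_K^{dV/2}`,
so the orbit-direction factor `∫_{ball ρ} dZ ∕ ν((e '' ball ρ)·Sst)` is ONE NUMBER for all four corners and CANCELS in the 4-point — no Faddeev–Popov ∕ orbit-volume
identification is needed on the common-tube route (w5 LOCATE 20:38Z∕20:53Z; w4-20520 g15 LOCATE-DECAY §3).

WHAT.  §1 `map_withDensity_restrict_comp_of_measurePreserving` — transport of a restricted density along a measure-preserving measurable equivalence (pure measure theory);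
§2 ★★★ `laplaceLimit_of_charts_tendsto_shift` — the shifted-base LIMIT-INST (hypothesis form: the product-tube rows at base `0` + the point rows at `y₁`).

HONEST SCOPE.  A door over ✓p740884; proves no stub; EXW ∕ GAP♯ ∕ FOUR-POINT-DECAY ∕ H4ᶜ ∕ LFR♯ᶜ ∕ LAPLACE ∕ S2β ∕ the crux 20520 NOT proved; `YM3TorusSU2` NOT proved;
the Yang–Mills mass gap (Clay) NOT proved.

References: [Breitung1994] Thm 41 p. 56; [Balaban1985Variational] CMP 102 (1985) Thm 1 (8)–(10) p. 279, (142) p. 299; [Helgason2000] Ch. I §1 Thm 1.14 p. 96.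
-/

noncomputable section

open MeasureTheory MeasureTheory.Measure Filter Topology Set Module Metric Function
open scoped Real InnerProductSpace ENNReal NNReal Pointwise
open Literature.MathematicalPhysics.QuantumFieldTheory.Balaban1983to89
open Literature.MathematicalPhysics.QuantumFieldTheory.Balaban1983to89.T3ContinuumYM3Torus
open Literature.MathematicalPhysics.QuantumFieldTheory.Balaban1983to89.T3UnitLawDensityEML
open scoped Literature.MathematicalPhysics.QuantumFieldTheory.Balaban1983to89.T3OrbitAverage
open Summit.QuantumFields.YangMills.Theorems.FluctuationComparisonRegPrIntLWregGlue
open Summit.QuantumFields.YangMills.Theorems.FluctuationComparisonRegPrIntLS2BetaLaplaceInst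
open Summit.QuantumFields.YangMills.Theorems.FluctuationComparisonRegPrIntLS2BetaLaplaceInstLocal

namespace Summit.QuantumFields.YangMills.Theorems.FluctuationComparisonRegPrIntLS2BetaLaplaceInstShift

/-! ## §1 Transport of a restricted density along a measure-preserving equivalence -/

/-- **TRANSPORT OF A RESTRICTED DENSITY.**  For a measure-preserving measurable embedding `τ` of `λ` and any set `W` and density `D`:
`((λ|_{τ⁻¹ W}) · (D ∘ τ)) ∘ τ⁻¹ = λ|_W · D`, i.e. `map τ ((λ.restrict (τ ⁻¹' W)).withDensity (D ∘ τ)) = (λ.restrict W).withDensity D`. [folklore] -/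
theorem map_withDensity_restrict_comp_of_measurePreserving {α : Type*} [MeasurableSpace α] {μ : Measure α} {τ : α → α}
    (hτ : MeasurePreserving τ μ μ) (hτe : MeasurableEmbedding τ) (W : Set α) (D : α → ℝ≥0∞) :
    ((μ.restrict (τ ⁻¹' W)).withDensity (fun x => D (τ x))).map τ = (μ.restrict W).withDensity D := by
  ext s hs
  rw [Measure.map_apply hτe.measurable hs, withDensity_apply _ (hτe.measurable hs), withDensity_apply _ hs,
    Measure.restrict_restrict (hτe.measurable hs), Measure.restrict_restrict hs, ← Set.preimage_inter]
  exact hτ.setLIntegral_comp_preimage_emb hτe _ _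

/-! ## §2 LIMIT-INST at a shifted base point of a product tube -/

/-- ★★★ **(CT) LIMIT-INST AT A SHIFTED BASE POINT OF A PRODUCT TUBE.**  The binders of ✓`laplaceLimit_of_charts_tendsto_local` with the tube block replaced by px21's
PRODUCT rows at base `0` — window `UZ ×ˢ UV`, density `dZ z · dV y`, `closedBall 0 ρ ⊆ UZ` — plus the POINT rows at the shifted base `y₁ ∈ UV`:
openness of the tube map at `(0, y₁)` ((F3)), the LOCAL carrier row `∀ᶠ y in 𝓝 y₁, σ y ∈ Xc`, the stabiliser row, EXW's two rows and GAP♯'s strictness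
at `σ y₁`, and the Peano row of `y ↦ A(Φ_V(σ(y₁ + y)))` with operator `Ah`.  Conclusion: the scaled restricted partition function tends to
`(2π)^{dV/2}·ν(univ)·(((∫_{ball ρ} dZ)·dV y₁) ∕ ν((e '' ball ρ)·Sst))·jac(σ y₁) ∕ √det Ah ∕ β_K^{dV/2}` (positivity of `∫_{ball ρ} dZ`, `dV y₁` is NOT needed for the
limit statement; the consumer uses it only to take logarithms).  Proof: ✓`_tendsto_local` for the translated data
`σ ∘ (y₁ + ·)`, `{p | (p.1, y₁ + p.2) ∈ UZ ×ˢ UV}`, `dZ p.1 · dV (y₁ + p.2)`; the chart identity transports along the `volume`-preserving translation (§1).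
[cite: Breitung1994, Thm 41 p.56] [cite: Balaban1985Variational, Thm 1 (8)-(10) p.279] [cite: Helgason2000, Ch. I §1 Thm 1.14 p.96] -/
theorem laplaceLimit_of_charts_tendsto_shift
    (F : T3Family) {γ : ℝ} (hγ : 0 < γ) {J K : ℕ} (hJK : J ≤ K)
    {Sf : Set (GaugeField (F.P K) 0 (Matrix.specialUnitaryGroup (Fin 2) ℂ))} (hSf : MeasurableSet Sf)
    {O : Set (GaugeField (F.P J) 0 (Matrix.specialUnitaryGroup (Fin 2) ℂ))} (hO : IsOpen O)
    (c : WindowChart F hJK Sf O) {V : GaugeField (F.P J) 0 (Matrix.specialUnitaryGroup (Fin 2) ℂ)} (hV : V ∈ O) (m : ℝ)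
    (S : Subgroup (Site (F.P K) 0 → Matrix.specialUnitaryGroup (Fin 2) ℂ)) (hS : CompactSpace S)
    (ν : Measure (S × (PBond (F.P K) (K - J) → Matrix.specialUnitaryGroup (Fin 2) ℂ))) [ν.IsHaarMeasure]
    (act : S × (PBond (F.P K) (K - J) → Matrix.specialUnitaryGroup (Fin 2) ℂ) →
      GaugeField (F.P K) 0 (Matrix.specialUnitaryGroup (Fin 2) ℂ) → GaugeField (F.P K) 0 (Matrix.specialUnitaryGroup (Fin 2) ℂ))
    (hact : Continuous fun p : (S × (PBond (F.P K) (K - J) → Matrix.specialUnitaryGroup (Fin 2) ℂ)) ×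
      GaugeField (F.P K) 0 (Matrix.specialUnitaryGroup (Fin 2) ℂ) => act p.1 p.2)
    (hmul : ∀ k k' z, act (k * k') z = act k (act k' z)) (hone : ∀ z, act 1 z = z)
    (hpres : ∀ k, MeasurePreserving (act k) (fieldMeasure (F.P K) 0 (Matrix.specialUnitaryGroup (Fin 2) ℂ))
      (fieldMeasure (F.P K) 0 (Matrix.specialUnitaryGroup (Fin 2) ℂ)))
    -- CHART∞ rows at `V`
    {Xc : Set (GaugeField (F.P K) 0 (Matrix.specialUnitaryGroup (Fin 2) ℂ))} (hXc : IsCompact Xc) (hXinv : ∀ k z, z ∈ Xc → act k z ∈ Xc)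
    (hvan : ∀ z, z ∉ Xc → (c.jac (V, z) : ℝ) = 0)
    (hA : ContinuousOn (fun z => wilsonAction4 (c.Φ (V, z))) Xc) (ha : ContinuousOn (fun z => (c.jac (V, z) : ℝ)) Xc)
    (hAinv : ∀ k, ∀ z ∈ Xc, wilsonAction4 (c.Φ (V, act k z)) = wilsonAction4 (c.Φ (V, z)))
    (hainv : ∀ k, ∀ z ∈ Xc, (c.jac (V, act k z) : ℝ) = c.jac (V, z))
    (hOrel : IsOpen ((Subtype.val : Xc → GaugeField (F.P K) 0 (Matrix.specialUnitaryGroup (Fin 2) ℂ)) ⁻¹' {z | c.Φ (V, z) ∈ Sf}))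
    (hOinv : ∀ k, ∀ z ∈ Xc, c.Φ (V, z) ∈ Sf → c.Φ (V, act k z) ∈ Sf)
    -- the PRODUCT tube at base `0` (px21 (F1)(F2)): group chart `e`, transversal `σ`, window `UZ ×ˢ UV`, density `dZ ⊗ dV`
    {dZ dV : ℕ} (e : EuclideanSpace ℝ (Fin dZ) → S × (PBond (F.P K) (K - J) → Matrix.specialUnitaryGroup (Fin 2) ℂ))
    (σ : EuclideanSpace ℝ (Fin dV) → GaugeField (F.P K) 0 (Matrix.specialUnitaryGroup (Fin 2) ℂ))
    (he : Continuous e) (he1 : e 0 = 1) (he𝓝 : 𝓝 (1 : S × (PBond (F.P K) (K - J) → Matrix.specialUnitaryGroup (Fin 2) ℂ)) ≤ map e (𝓝 0))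
    (hσ : Continuous σ)
    {UZ : Set (EuclideanSpace ℝ (Fin dZ))} {UV : Set (EuclideanSpace ℝ (Fin dV))} (hUZo : IsOpen UZ) (hUVo : IsOpen UV)
    (hinj : InjOn (fun p : EuclideanSpace ℝ (Fin dZ) × EuclideanSpace ℝ (Fin dV) => act (e p.1) (σ p.2)) (UZ ×ˢ UV))
    {dZf : EuclideanSpace ℝ (Fin dZ) → ℝ} {dVf : EuclideanSpace ℝ (Fin dV) → ℝ} (hdZc : ContinuousOn dZf UZ) (hdVc : ContinuousOn dVf UV)
    (hdZ0 : ∀ z ∈ UZ, 0 ≤ dZf z) (hdV0 : ∀ y ∈ UV, 0 ≤ dVf y)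
    (hchart : (fieldMeasure (F.P K) 0 (Matrix.specialUnitaryGroup (Fin 2) ℂ)).restrict
        ((fun p : EuclideanSpace ℝ (Fin dZ) × EuclideanSpace ℝ (Fin dV) => act (e p.1) (σ p.2)) '' (UZ ×ˢ UV)) =
      ((((volume : Measure (EuclideanSpace ℝ (Fin dZ))).prod (volume : Measure (EuclideanSpace ℝ (Fin dV)))).restrict (UZ ×ˢ UV)).withDensity
          fun w => ENNReal.ofReal (dZf w.1 * dVf w.2)).map (fun p : EuclideanSpace ℝ (Fin dZ) × EuclideanSpace ℝ (Fin dV) => act (e p.1) (σ p.2)))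
    {ρ : ℝ} (hρ : 0 < ρ) (hρUZ : closedBall (0 : EuclideanSpace ℝ (Fin dZ)) ρ ⊆ UZ)
    -- the POINT rows at the shifted base `y₁` (px21 (F3) + CHART∞ local carrier + stabiliser)
    {y₁ : EuclideanSpace ℝ (Fin dV)} (hy₁ : y₁ ∈ UV)
    (hopen₁ : 𝓝 (σ y₁) ≤ map (fun p : EuclideanSpace ℝ (Fin dZ) × EuclideanSpace ℝ (Fin dV) => act (e p.1) (σ p.2)) (𝓝 (0, y₁)))
    (hσX₁ : ∀ᶠ y in 𝓝 y₁, σ y ∈ Xc)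
    {Sst : Set (S × (PBond (F.P K) (K - J) → Matrix.specialUnitaryGroup (Fin 2) ℂ))}
    (hstab₁ : ∀ k, act k (σ y₁) = σ y₁ → k ∈ Sst) (hfix : ∀ s ∈ Sst, ∀ y, act s (σ y) = σ y)
    -- EXW rows at the shifted base
    (hO0 : c.Φ (V, σ y₁) ∈ Sf) (hmin : wilsonAction4 (c.Φ (V, σ y₁)) = m)
    -- GAP♯ rows at `V`
    {g : GaugeField (F.P K) 0 (Matrix.specialUnitaryGroup (Fin 2) ℂ) → ℝ} (hg : ContinuousOn g Xc) (hg0 : ∀ z ∈ Xc, 0 ≤ g z)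
    (hgpos : ∀ z ∈ Xc, (∀ k, act k (σ y₁) ≠ z) → 0 < g z)
    (hgrow : ∀ z ∈ Xc, c.Φ (V, z) ∈ Sf → m + g z ≤ wilsonAction4 (c.Φ (V, z)))
    -- the Peano row at the shifted base
    {Ah : EuclideanSpace ℝ (Fin dV) →ₗ[ℝ] EuclideanSpace ℝ (Fin dV)} (hAs : Ah.IsSymmetric) (hpos : ∀ y, y ≠ 0 → 0 < ⟪Ah y, y⟫_ℝ)
    (hS2 : (fun y => wilsonAction4 (c.Φ (V, σ (y₁ + y))) - wilsonAction4 (c.Φ (V, σ y₁)) - (1 / 2) * ⟪Ah y, y⟫_ℝ) =o[𝓝 0] fun y => ‖y‖ ^ 2) :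
    Tendsto (fun lam : ℝ => lam ^ ((dV : ℝ) / 2) *
        (heightDensityCan F (γ / lam) hJK Sf V * Real.exp (lam * (F.scheme ℰp γ).β K * m))) atTop
      (𝓝 (((2 * π) ^ ((dV : ℝ) / 2) * (ν.real univ *
          (((∫ z in ball (0 : EuclideanSpace ℝ (Fin dZ)) ρ, dZf z) * dVf y₁) /
              (ν (((e '' ball (0 : EuclideanSpace ℝ (Fin dZ)) ρ) * Sst)⁻¹)).toReal * (c.jac (V, σ y₁) : ℝ) /
            Real.sqrt (LinearMap.det Ah)))) / ((F.scheme ℰp γ).β K) ^ ((dV : ℝ) / 2))) := by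
  classical
  -- the translation of the transversal coordinates and the translated data
  set τH : EuclideanSpace ℝ (Fin dZ) × EuclideanSpace ℝ (Fin dV) ≃ₜ EuclideanSpace ℝ (Fin dZ) × EuclideanSpace ℝ (Fin dV) :=
    (Homeomorph.refl (EuclideanSpace ℝ (Fin dZ))).prodCongr (Homeomorph.addLeft y₁) with hτH
  have hτ_apply : ∀ p : EuclideanSpace ℝ (Fin dZ) × EuclideanSpace ℝ (Fin dV), τH p = (p.1, y₁ + p.2) := fun p => rfl
  have hτ0 : τH 0 = (0, y₁) := by rw [hτ_apply]; simp
  set σ' : EuclideanSpace ℝ (Fin dV) → GaugeField (F.P K) 0 (Matrix.specialUnitaryGroup (Fin 2) ℂ) := fun y => σ (y₁ + y) with hσ'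
  have hσ'0 : σ' 0 = σ y₁ := by simp [hσ']
  set W' : Set (EuclideanSpace ℝ (Fin dZ) × EuclideanSpace ℝ (Fin dV)) := τH ⁻¹' (UZ ×ˢ UV) with hW'
  set Jd' : EuclideanSpace ℝ (Fin dZ) × EuclideanSpace ℝ (Fin dV) → ℝ := fun p => dZf p.1 * dVf (y₁ + p.2) with hJd'
  set Θ : EuclideanSpace ℝ (Fin dZ) × EuclideanSpace ℝ (Fin dV) → GaugeField (F.P K) 0 (Matrix.specialUnitaryGroup (Fin 2) ℂ) :=
    fun p => act (e p.1) (σ p.2) with hΘ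
  have hΘ' : (fun p : EuclideanSpace ℝ (Fin dZ) × EuclideanSpace ℝ (Fin dV) => act (e p.1) (σ' p.2)) = Θ ∘ τH := by
    funext p; simp [hΘ, hσ', hτ_apply]
  have hΘc : Continuous Θ := hact.comp ((he.comp continuous_fst).prodMk (hσ.comp continuous_snd))
  have hΘm : Measurable Θ := hΘc.measurable
  -- the translated rows
  have hσ'c : Continuous σ' := hσ.comp (continuous_const.add continuous_id)
  have hσ'X : ∀ᶠ y in 𝓝 (0 : EuclideanSpace ℝ (Fin dV)), σ' y ∈ Xc := by
    have ht : Tendsto (fun y : EuclideanSpace ℝ (Fin dV) => y₁ + y) (𝓝 0) (𝓝 y₁) :=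
      (show Continuous (fun y : EuclideanSpace ℝ (Fin dV) => y₁ + y) from continuous_const.add continuous_id).tendsto' 0 y₁ (add_zero y₁)
    exact ht.eventually hσX₁
  have hΘ'𝓝 : 𝓝 (σ' 0) ≤ map (fun p : EuclideanSpace ℝ (Fin dZ) × EuclideanSpace ℝ (Fin dV) => act (e p.1) (σ' p.2)) (𝓝 0) := by
    rw [hΘ', ← Filter.map_map, τH.map_nhds_eq, hτ0, hσ'0]
    exact hopen₁
  have hW'o : IsOpen W' := (hUZo.prod hUVo).preimage τH.continuous
  have hinj' : InjOn (fun p : EuclideanSpace ℝ (Fin dZ) × EuclideanSpace ℝ (Fin dV) => act (e p.1) (σ' p.2)) W' := by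
    rw [hΘ']
    intro p hp q hq hpq
    exact τH.injective (hinj hp hq hpq)
  have hJ'c : ContinuousOn Jd' W' := by
    refine ContinuousOn.mul (hdZc.comp continuous_fst.continuousOn fun p hp => hp.1)
      (hdVc.comp (continuous_const.add continuous_snd).continuousOn fun p hp => hp.2)
  have hJ'0 : ∀ w ∈ W', 0 ≤ Jd' w := fun w hw => mul_nonneg (hdZ0 _ hw.1) (hdV0 _ hw.2)
  -- the chart identity transports along the volume-preserving translation
  have hτmp : MeasurePreserving τH ((volume : Measure (EuclideanSpace ℝ (Fin dZ))).prod (volume : Measure (EuclideanSpace ℝ (Fin dV))))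
      ((volume : Measure (EuclideanSpace ℝ (Fin dZ))).prod (volume : Measure (EuclideanSpace ℝ (Fin dV)))) := by
    have h := (MeasurePreserving.id (volume : Measure (EuclideanSpace ℝ (Fin dZ)))).prod
      (measurePreserving_add_left (volume : Measure (EuclideanSpace ℝ (Fin dV))) y₁)
    have hcoe : (⇑τH) = Prod.map id (fun y : EuclideanSpace ℝ (Fin dV) => y₁ + y) := by funext p; rfl
    rw [hcoe]; exact h
  have hchart' : (fieldMeasure (F.P K) 0 (Matrix.specialUnitaryGroup (Fin 2) ℂ)).restrict
        ((fun p : EuclideanSpace ℝ (Fin dZ) × EuclideanSpace ℝ (Fin dV) => act (e p.1) (σ' p.2)) '' W') =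
      ((((volume : Measure (EuclideanSpace ℝ (Fin dZ))).prod (volume : Measure (EuclideanSpace ℝ (Fin dV)))).restrict W').withDensity
          fun w => ENNReal.ofReal (Jd' w)).map (fun p : EuclideanSpace ℝ (Fin dZ) × EuclideanSpace ℝ (Fin dV) => act (e p.1) (σ' p.2)) := by
    have himg : (Θ ∘ τH) '' W' = Θ '' (UZ ×ˢ UV) := by rw [Set.image_comp, hW', Set.image_preimage_eq _ τH.surjective]
    have htr : ((((volume : Measure (EuclideanSpace ℝ (Fin dZ))).prod (volume : Measure (EuclideanSpace ℝ (Fin dV)))).restrict W').withDensity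
        fun w => ENNReal.ofReal (Jd' w)).map τH =
        (((volume : Measure (EuclideanSpace ℝ (Fin dZ))).prod (volume : Measure (EuclideanSpace ℝ (Fin dV)))).restrict (UZ ×ˢ UV)).withDensity
          fun w => ENNReal.ofReal (dZf w.1 * dVf w.2) :=
      map_withDensity_restrict_comp_of_measurePreserving hτmp τH.measurableEmbedding (UZ ×ˢ UV)
        (fun w => ENNReal.ofReal (dZf w.1 * dVf w.2))
    rw [hΘ', himg, ← Measure.map_map hΘm τH.measurable, htr]
    exact hchart
  have hρW' : closedBall (0 : EuclideanSpace ℝ (Fin dZ)) ρ ×ˢ {(0 : EuclideanSpace ℝ (Fin dV))} ⊆ W' := by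
    rintro ⟨z, y⟩ ⟨hz, hy⟩
    have hy0 : y = 0 := hy
    show τH (z, y) ∈ UZ ×ˢ UV
    rw [hτ_apply, hy0, add_zero]
    exact ⟨hρUZ hz, hy₁⟩
  have hstab' : ∀ k, act k (σ' 0) = σ' 0 → k ∈ Sst := by rw [hσ'0]; exact hstab₁
  have hfix' : ∀ s ∈ Sst, ∀ y, act s (σ' y) = σ' y := fun s hs y => hfix s hs _
  have hO0' : c.Φ (V, σ' 0) ∈ Sf := by rw [hσ'0]; exact hO0
  have hmin' : wilsonAction4 (c.Φ (V, σ' 0)) = m := by rw [hσ'0]; exact hmin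
  have hgpos' : ∀ z ∈ Xc, (∀ k, act k (σ' 0) ≠ z) → 0 < g z := by rw [hσ'0]; exact hgpos
  have hS2' : (fun y => wilsonAction4 (c.Φ (V, σ' y)) - wilsonAction4 (c.Φ (V, σ' 0)) - (1 / 2) * ⟪Ah y, y⟫_ℝ) =o[𝓝 0] fun y => ‖y‖ ^ 2 := by
    have hfun : (fun y => wilsonAction4 (c.Φ (V, σ' y)) - wilsonAction4 (c.Φ (V, σ' 0)) - (1 / 2) * ⟪Ah y, y⟫_ℝ) =
        fun y => wilsonAction4 (c.Φ (V, σ (y₁ + y))) - wilsonAction4 (c.Φ (V, σ y₁)) - (1 / 2) * ⟪Ah y, y⟫_ℝ := by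
      funext y; simp only [hσ', add_zero]
    rw [hfun]; exact hS2
  -- LIMIT-INST (local edition) for the translated data
  have hlim := laplaceLimit_of_charts_tendsto_local F hγ hJK hSf hO c hV m S hS ν act hact hmul hone hpres hXc hXinv hvan hA ha hAinv hainv
    hOrel hOinv e σ' he he1 he𝓝 hσ'c hσ'X hΘ'𝓝 hW'o hinj' hJ'c hJ'0 hchart' hρ hρW' hstab' hfix' hO0' hmin' hg hg0 hgpos' hgrow hAs hpos hS2'
  have hI : (∫ z in ball (0 : EuclideanSpace ℝ (Fin dZ)) ρ, Jd' (z, 0)) = (∫ z in ball (0 : EuclideanSpace ℝ (Fin dZ)) ρ, dZf z) * dVf y₁ := by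
    simp only [hJd', add_zero]
    exact integral_mul_const _ _
  rw [hI, hσ'0] at hlim
  exact hlim

end Summit.QuantumFields.YangMills.Theorems.FluctuationComparisonRegPrIntLS2BetaLaplaceInstShift

end
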